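import Summits.QuantumFields.BalabanUV.Beta.GAN24.CombTowerEndAtPin
import Summits.QuantumFields.BalabanUV.Beta.GAN24.CombRelSourceHalfCharge
import Summits.QuantumFields.BalabanUV.Beta.GAN24.CombT2DriftEvenEnd
import Summits.QuantumFields.BalabanUV.Beta.GAN24.T2RecChargeLedger

/-!
# `BalabanUV.Beta.GAN24.CombChargeConservationRow` — binder row G-an2-4 ∕ (CONV-C), TRANSFER-III (the (α-0) chain at row D1's literal of record (III′)):
# **THE (C)^{ev} ROW OF THE (III′) END IN CONSERVATION CURRENCY — the G-an2-4 END at row D1's literal of record ⟸ (b) the S-slot rows of `ScombOf` ∧ (d′) «the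
# comb-chart `T₂` tower CONSERVES its bond-symmetrised ff zero-mode charge, level by level», NOTHING ELSE** — leaf-01 g73's (E) `RowCChargeForms` §1 («(C) of record ⟺
# conservation of the symmetrised charge along the dressed comb tower») and gan24-p2 g36's criterion `T2RecChargeStep.zmodeSym_sourceB_eq ∕ zfreeSym_sourceB_iff` RE-RUN at the
# comb-chart slot data `(GcombSh Lc ·, SpureCombOf tabs, tabs.M, tabs.vh₂S, tabs.mixFF)` of ANY sym record `tabs : SymTables d Lc` (proof texts token for token: the B-frame
# source is read through the UNDRESSED unit step, so only the member's `LocStencil₂` class — leaf-01 g80's `CombRelSourceHalfCharge.locStencil₂_unitS₂_T2RecOf_comb` — and its joint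
# `Lc`-covariance — the OWNER g46's T5 `CombT2DriftEvenEnd.unitS₂_T2RecOf_comb_translate` — enter), then composed with leaf-01 g80's (C)^{ε} ⟸ (C) bridge
# `CombRelSourceHalfCharge.zsym_relSource_comb_half` at `ε = 1` and leaf-01 g83's `CombTowerEndAtPin` (OWNER `b2b-balaban-gan24-p1`, gen 50; no existing file touched)

NOT IN PRINT; OUR BOOKKEEPING ([folklore] compositions BY NAME at weight 0; 0 `def`, 0 cited facts, 0 `def … : Prop`, 0 sorry).  HONEST FRAMING (cell contract,
verbatim): «discharging `BetaPertH` makes Bałaban's UV stability UNCONDITIONAL — a real constructive-QFT result; it is NOT the continuum limit and NOT the Clay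
problem.»  HONEST DEPENDENCY (verbatim): «continuum YM on T⁴ ⇐ BetaPertH ∧ nine spine estimates (0/9 proved); BetaPertH ⇐ (D1) ∧ (D4) ∧ CAP+tail; G-an2-4 gates
asym, D1 and NE2/3/4.»

WHY.  After leaf-01 g83's PIN twin the (III′) END `CombTowerEndAtPin.exists_allScalesSeq_JsB12CombShSym_an1_of_sRows_at_pin` displays exactly (b) the S-slot rows and (d) the
(C)^{ev} zero-mode row `hC` — the latter in the (C-6) junction spelling (even member's relative source, forcing + cell).  The OWNER's sizing note `gen50/C-ROW-AT-COMB-SIZING-g50.md`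
puts the (III′) (C)-campaign at ≈ 30 ± 8 modules with ≈ 12–15 VALUE files of unknown numbers — ENGINE FIRST; the engine's natural currency is NOT the junction spelling but the
plain statement «`zmodeSym_Lc (T̃′♮_{l+1}) = zmodeSym_Lc (T̃′♮_l)` for every `l`».  This file makes that statement the END's displayed row, so the decisive computation (E0 of the
note: one level, `d = 3`, `Lc = 3`, an1's record, exact) tests EXACTLY what the tree consumes.

WHAT (`T̃′♮_j := unitS₂_j (T2RecOf d Lc (GcombSh Lc) (SpureCombOf tabs cE cVH cΛ) tabs.M cE₂ cB Tc tabs.vh₂S tabs.mixFF j)`, `𝒜^K_j := lin4 (cE₂·Lc^{2(d+1)}) (unitK_j (KInvStep Lc j)) Lc`,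
`σ′_j := T̃′♮_{j+1} − 𝒜^K_j T̃′♮_j` the B-frame (relative) source, `zmodeSym_N (X)(μν;αβ) := zmode N X μ ν (inl α) (inl β) + zmode N X ν μ (inl α) (inl β)`):
* §1 (generic `d`, ANY `tabs : SymTables d Lc`, every `N j`, NO pin) **`zmodeSym_sourceB_comb_eq`** — `zmodeSym_N (σ′_j) = zmodeSym_N (T̃′♮_{j+1}) − N^{d+1}·(cE₂·Lc^{2(d+1)})·Lc^{−4(d+2)}·
  zmodeSym_Lc (T̃′♮_j)`; **`zfreeSym_sourceB_comb_iff`** — the criterion form.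
* §2 (generic `d`, pin `cE₂ = Lc^{d+5}`) **`zsymMember_comb_succ_eq_iff_rowC`** — row (C) at the comb data (R-HYB′ form, the `hC` of `CombRelSourceHalfCharge.zsym_relSource_comb_half`)
  at level `l` ⟺ `zmodeSym_Lc (T̃′♮_{l+1}) = zmodeSym_Lc (T̃′♮_l)`; **`zsymMember_comb_eq_zero_level_of_rowC`** ∕ **`rowC_comb_of_zsymMember_eq_zero_level`** ∕
  **`rowC_comb_iff_zsymMember_conserved`** — (C) at every level ⟺ the charge is its level-`0` value at every level.
* §2b **`zmode_member_zero_comb`** (generic `d`, any `N`, border without ff block): the conserved VALUE — member `0`'s ff charge is gan24-p2's Wilson closed form `cE₂·N^{d+1}·Z₄(Tc)`.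
* §3 (`d = 3`, `Lc` odd, `2 ≤ Lc`, `2 ≤ N`, an1's record `symTablesAn1S2 3 Lc cΛ`, the two unit locks `cΛ·Lc⁴ = 2`, `cB = −Lc¹²∕4`; the END's pins `cE = Lc⁴`, `cVH = −Lc⁸∕2`,
  `cE₂ = Lc⁸`, `Tc = (8N²)⁻¹ • wsym22 N` written in) **`exists_allScalesSeq_JsB12CombShSym_an1_of_sRows_chargeConserved`** —
  `∃ κ θ<1, AllScalesSeq (j ↦ secondMoment (TbalOf Lc (JsB12CombShSym hLc N (symTablesAn1S2 3 Lc cΛ) cΛ cB) j) μ ν) κ θ` ⟸ (b) the S-slot rows (hS, hSall) of `ScombOf` ∧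
  (d′) `∀ l, zmodeSym_Lc (T̃′♮_{l+1}) = zmodeSym_Lc (T̃′♮_l)` — NOTHING ELSE; **`d1Drift_JsB12CombShSym_an1_iff_lim_eq_of_sRows_chargeConserved`** — row D1's reading under the
  same two rows (the VALUE `lim β = stepBal Nc Lc` is row D1's and is NOT proved).
WHAT THIS IS NOT.  (b) and (d′) are DISPLAYED; (d′) is NOT proved (its truth at the comb data is the engine question E0); asserts NO value of Bałaban's tables and NO value of any
charge beyond the identities above; NOT one S-∕W-slot row discharged as a VALUE; the (III′) campaign is NOT asked (an2 W-4 l.64553) — zero weight; NEVER «G-an2-4 closed» as (CONV-C);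
NOT D1, NOT `BetaPertH`, NOT continuum, NOT Clay; not in print.  2026-08-26.
-/

noncomputable section

open Finset
open scoped BigOperators
open Literature.MathematicalPhysics.QuantumFieldTheory
open Literature.MathematicalPhysics.QuantumFieldTheory.Balaban1983to89
open Literature.MathematicalPhysics.QuantumFieldTheory.Balaban1983to89.Beta
open RemainderConstAllScales (AllScalesSeq)
open ExpKernelCalculus (MKer Decays shiftK)
open OneStepResolventKernel (Fib LocStencil decays_mono)
open OneStepKernelFamily (KInvStep decays_KInvStep TbalOf D1Drift)
open AffineAveraging (box toSite)
open BalabanCompositeJets (LocStencil₂ LocStencil₂.mono)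
open SecondOrderResponse (W2SymOfK)
open BalabanStepJetsSucc (mmRead)
open BalabanStepW2 (K3OfK M2Of)
open WilsonVertex2Sym (wsym22)
open Summit.QuantumFields.BalabanUV.Beta.TameKernelCalculus (trK)
open Summit.QuantumFields.BalabanUV.Beta.BorderedHessian (sgnK)
open Summit.QuantumFields.BalabanUV.Beta.HessKerDressedUnits (unitK unitS decays_unitK)
open Summit.QuantumFields.BalabanUV.Beta.SecondOrderUnits (unitM unitS₂ unitM₂)
open Summit.QuantumFields.BalabanUV.Beta.SpineRooted (T2RecOf T2RecAt T2RecOf_zero_level T2RecAt_zero_level)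
open WilsonBiStencil (wilsonW₂)
open Summit.QuantumFields.BalabanUV.Beta.SymmetrisedStepJets (SymTables)
open Summit.QuantumFields.BalabanUV.Beta.CombChartStepJets (GcombSh ScombOf SpureCombOf)
open Summit.QuantumFields.BalabanUV.Beta.CombChartJointEnd (JsB12CombShSym)
open Summit.QuantumFields.BalabanUV.Beta.SymSecondOrderTablesAn1 (symTablesAn1S2)
open Summit.QuantumFields.BalabanUV.Beta.GAN24.CombesThomas (sfStep smStep)
open Summit.QuantumFields.BalabanUV.Beta.GAN24.T2RecursionAffine (lin4)
open Summit.QuantumFields.BalabanUV.Beta.GAN24.BiStencilZeroMode (Tab zmode)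
open Summit.QuantumFields.BalabanUV.Beta.GAN24.WSlotFirstDiff (zmode_sub)
open Summit.QuantumFields.BalabanUV.Beta.GAN24.Lin4ZeroMode (locStencil₂_lin4 zmode_lin4_step)
open Summit.QuantumFields.BalabanUV.Beta.GAN24.T2RecChargeLedger (charge_factor_eq_one_of_pinEq)
open Summit.QuantumFields.BalabanUV.Beta.GAN24.T2RecChargeStep (zmode_member_zero)
open Summit.QuantumFields.BalabanUV.Beta.GAN24.CombRelSourceHalfCharge (locStencil₂_unitS₂_T2RecOf_comb zsym_relSource_comb_half)
open Summit.QuantumFields.BalabanUV.Beta.GAN24.CombT2DriftEvenEnd (unitS₂_T2RecOf_comb_translate)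
open Summit.QuantumFields.BalabanUV.Beta.GAN24.CombTowerEndAtPin (exists_allScalesSeq_JsB12CombShSym_an1_of_sRows_at_pin
  d1Drift_JsB12CombShSym_an1_iff_lim_eq_of_sRows_at_pin)

namespace Summit.QuantumFields.BalabanUV.Beta.GAN24.CombChargeConservationRow

variable {d : ℕ} {Lc : ℕ} [NeZero Lc]

/-! ## §1 The bond-symmetrised charge of the comb-chart B-frame source (generic `d`, any sym record, no pin) -/

/-- NOT IN PRINT; OUR BOOKKEEPING ([folklore]; `zmode_sub` + `zmode_lin4_step` on the UNDRESSED linear image of the comb-chart member; the (III′) twin of gan24-p2 g36's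
`T2RecChargeStep.zmodeSym_sourceB_eq`).  **THE BOND-SYMMETRISED CHARGE OF THE COMB-CHART B-FRAME SOURCE** `σ′_j := T̃′♮_{j+1} − 𝒜^K_j T̃′♮_j`:
`zmodeSym_N (σ′_j) = zmodeSym_N (T̃′♮_{j+1}) − N^{d+1}·(cE₂·Lc^{2(d+1)})·Lc^{−4(d+2)}·zmodeSym_Lc (T̃′♮_j)` — every `j`, every `N`, any record `tabs`, NO pin. -/
theorem zmodeSym_sourceB_comb_eq (tabs : SymTables d Lc) (cE cVH cΛ cE₂ cB : ℝ) (Tc : Fin 4 → Fin 4 → Fin 4 → Fin 4 → ℝ)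
    (N j : ℕ) (μ ν α β : Fin (d + 1)) :
    zmode N (fun κ u κ' u' =>
          unitS₂ (sfStep Lc (j + 1)) (smStep d Lc (j + 1)) (T2RecOf d Lc (GcombSh Lc) (SpureCombOf tabs cE cVH cΛ) tabs.M cE₂ cB Tc tabs.vh₂S tabs.mixFF (j + 1)) κ u κ' u'
        - lin4 (cE₂ * (Lc : ℝ) ^ (2 * (d + 1))) (unitK (sfStep Lc j) (smStep d Lc j) (KInvStep (d := d) Lc j)) Lc
            (unitS₂ (sfStep Lc j) (smStep d Lc j) (T2RecOf d Lc (GcombSh Lc) (SpureCombOf tabs cE cVH cΛ) tabs.M cE₂ cB Tc tabs.vh₂S tabs.mixFF j)) κ u κ' u')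
          μ ν (Sum.inl α) (Sum.inl β)
      + zmode N (fun κ u κ' u' =>
          unitS₂ (sfStep Lc (j + 1)) (smStep d Lc (j + 1)) (T2RecOf d Lc (GcombSh Lc) (SpureCombOf tabs cE cVH cΛ) tabs.M cE₂ cB Tc tabs.vh₂S tabs.mixFF (j + 1)) κ u κ' u'
        - lin4 (cE₂ * (Lc : ℝ) ^ (2 * (d + 1))) (unitK (sfStep Lc j) (smStep d Lc j) (KInvStep (d := d) Lc j)) Lc
            (unitS₂ (sfStep Lc j) (smStep d Lc j) (T2RecOf d Lc (GcombSh Lc) (SpureCombOf tabs cE cVH cΛ) tabs.M cE₂ cB Tc tabs.vh₂S tabs.mixFF j)) κ u κ' u')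
          ν μ (Sum.inl α) (Sum.inl β)
      = (zmode N (unitS₂ (sfStep Lc (j + 1)) (smStep d Lc (j + 1)) (T2RecOf d Lc (GcombSh Lc) (SpureCombOf tabs cE cVH cΛ) tabs.M cE₂ cB Tc tabs.vh₂S tabs.mixFF (j + 1)))
            μ ν (Sum.inl α) (Sum.inl β)
          + zmode N (unitS₂ (sfStep Lc (j + 1)) (smStep d Lc (j + 1)) (T2RecOf d Lc (GcombSh Lc) (SpureCombOf tabs cE cVH cΛ) tabs.M cE₂ cB Tc tabs.vh₂S tabs.mixFF (j + 1)))
            ν μ (Sum.inl α) (Sum.inl β))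
        - ((N : ℝ) ^ (d + 1)) * ((cE₂ * (Lc : ℝ) ^ (2 * (d + 1))) * (((Lc : ℝ) ^ (d + 1 + 1))⁻¹) ^ 4) *
          (zmode Lc (unitS₂ (sfStep Lc j) (smStep d Lc j) (T2RecOf d Lc (GcombSh Lc) (SpureCombOf tabs cE cVH cΛ) tabs.M cE₂ cB Tc tabs.vh₂S tabs.mixFF j))
              μ ν (Sum.inl α) (Sum.inl β)
            + zmode Lc (unitS₂ (sfStep Lc j) (smStep d Lc j) (T2RecOf d Lc (GcombSh Lc) (SpureCombOf tabs cE cVH cΛ) tabs.M cE₂ cB Tc tabs.vh₂S tabs.mixFF j))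
              ν μ (Sum.inl α) (Sum.inl β)) := by
  obtain ⟨CT, δT, hδT, hT⟩ := locStencil₂_unitS₂_T2RecOf_comb tabs cE cVH cΛ cE₂ cB Tc j
  obtain ⟨C1, δ1, hδ1, hT1⟩ := locStencil₂_unitS₂_T2RecOf_comb tabs cE cVH cΛ cE₂ cB Tc (j + 1)
  have hTcov := unitS₂_T2RecOf_comb_translate tabs cE cVH cΛ cE₂ cB Tc j
  obtain ⟨m, CK, hm, hCK, hK⟩ := decays_KInvStep (d := d) (Lc := Lc) j
  have hA := locStencil₂_lin4 (decays_unitK (sf := sfStep Lc j) (sm := smStep d Lc j) hK) (by positivity) hm (NeZero.one_le (n := Lc))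
    (cE₂ * (Lc : ℝ) ^ (2 * (d + 1))) hT hδT
  have hr0 : 0 < min δ1 (min m δT / 128) := lt_min hδ1 (by positivity)
  rw [zmode_sub (N := N) (hT1.mono (min_le_left _ _)) (hA.mono (min_le_right _ _)) hr0,
    zmode_sub (N := N) (hT1.mono (min_le_left _ _)) (hA.mono (min_le_right _ _)) hr0,
    zmode_lin4_step (NeZero.one_le (n := Lc)) N j (cE₂ * (Lc : ℝ) ^ (2 * (d + 1))) hT hδT hTcov μ ν α β,
    zmode_lin4_step (NeZero.one_le (n := Lc)) N j (cE₂ * (Lc : ℝ) ^ (2 * (d + 1))) hT hδT hTcov ν μ α β]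
  ring

/-- NOT IN PRINT; OUR BOOKKEEPING.  **THE CONSERVATION CRITERION AT THE COMB DATA** (§1 rearranged; the twin of `T2RecChargeStep.zfreeSym_sourceB_iff`): the comb-chart B-frame
source `σ′_j` has vanishing bond-symmetrised ff charge at `(μ,ν;α,β)` IFF `zmodeSym_N (T̃′♮_{j+1}) = N^{d+1}·(cE₂·Lc^{2(d+1)})·Lc^{−4(d+2)}·zmodeSym_Lc (T̃′♮_j)` there
(at `N = Lc`, `cE₂ = Lc^{d+5}` the factor is `1`: CHARGE CONSERVATION). -/
theorem zfreeSym_sourceB_comb_iff (tabs : SymTables d Lc) (cE cVH cΛ cE₂ cB : ℝ) (Tc : Fin 4 → Fin 4 → Fin 4 → Fin 4 → ℝ)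
    (N j : ℕ) (μ ν α β : Fin (d + 1)) :
    (zmode N (fun κ u κ' u' =>
          unitS₂ (sfStep Lc (j + 1)) (smStep d Lc (j + 1)) (T2RecOf d Lc (GcombSh Lc) (SpureCombOf tabs cE cVH cΛ) tabs.M cE₂ cB Tc tabs.vh₂S tabs.mixFF (j + 1)) κ u κ' u'
        - lin4 (cE₂ * (Lc : ℝ) ^ (2 * (d + 1))) (unitK (sfStep Lc j) (smStep d Lc j) (KInvStep (d := d) Lc j)) Lc
            (unitS₂ (sfStep Lc j) (smStep d Lc j) (T2RecOf d Lc (GcombSh Lc) (SpureCombOf tabs cE cVH cΛ) tabs.M cE₂ cB Tc tabs.vh₂S tabs.mixFF j)) κ u κ' u')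
          μ ν (Sum.inl α) (Sum.inl β)
      + zmode N (fun κ u κ' u' =>
          unitS₂ (sfStep Lc (j + 1)) (smStep d Lc (j + 1)) (T2RecOf d Lc (GcombSh Lc) (SpureCombOf tabs cE cVH cΛ) tabs.M cE₂ cB Tc tabs.vh₂S tabs.mixFF (j + 1)) κ u κ' u'
        - lin4 (cE₂ * (Lc : ℝ) ^ (2 * (d + 1))) (unitK (sfStep Lc j) (smStep d Lc j) (KInvStep (d := d) Lc j)) Lc
            (unitS₂ (sfStep Lc j) (smStep d Lc j) (T2RecOf d Lc (GcombSh Lc) (SpureCombOf tabs cE cVH cΛ) tabs.M cE₂ cB Tc tabs.vh₂S tabs.mixFF j)) κ u κ' u')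
          ν μ (Sum.inl α) (Sum.inl β) = 0)
    ↔ zmode N (unitS₂ (sfStep Lc (j + 1)) (smStep d Lc (j + 1)) (T2RecOf d Lc (GcombSh Lc) (SpureCombOf tabs cE cVH cΛ) tabs.M cE₂ cB Tc tabs.vh₂S tabs.mixFF (j + 1)))
            μ ν (Sum.inl α) (Sum.inl β)
          + zmode N (unitS₂ (sfStep Lc (j + 1)) (smStep d Lc (j + 1)) (T2RecOf d Lc (GcombSh Lc) (SpureCombOf tabs cE cVH cΛ) tabs.M cE₂ cB Tc tabs.vh₂S tabs.mixFF (j + 1)))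
            ν μ (Sum.inl α) (Sum.inl β)
        = ((N : ℝ) ^ (d + 1)) * ((cE₂ * (Lc : ℝ) ^ (2 * (d + 1))) * (((Lc : ℝ) ^ (d + 1 + 1))⁻¹) ^ 4) *
          (zmode Lc (unitS₂ (sfStep Lc j) (smStep d Lc j) (T2RecOf d Lc (GcombSh Lc) (SpureCombOf tabs cE cVH cΛ) tabs.M cE₂ cB Tc tabs.vh₂S tabs.mixFF j))
              μ ν (Sum.inl α) (Sum.inl β)
            + zmode Lc (unitS₂ (sfStep Lc j) (smStep d Lc j) (T2RecOf d Lc (GcombSh Lc) (SpureCombOf tabs cE cVH cΛ) tabs.M cE₂ cB Tc tabs.vh₂S tabs.mixFF j))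
              ν μ (Sum.inl α) (Sum.inl β)) := by
  rw [zmodeSym_sourceB_comb_eq tabs cE cVH cΛ cE₂ cB Tc N j μ ν α β, sub_eq_zero]

/-! ## §2 Row (C) at the comb data ⟺ conservation of the symmetrised ff charge (generic `d`, pin `cE₂ = Lc^{d+5}`) -/

/-- NOT IN PRINT; OUR BOOKKEEPING.  **ROW (C) AT THE COMB DATA ⟺ ONE-STEP CONSERVATION AT LEVEL `l`** (the twin of leaf-01 g73's `RowCChargeForms.zsymMember_succ_eq_iff_rowC`):
at the pin `cE₂ = Lc^{d+5}` the B-frame source `σ′_l` is bond-symmetrised ff zero-mode-free at `(κ,κ′;κ₁,κ₂)` — the `hC` row of leaf-01 g80's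
`CombRelSourceHalfCharge.zsym_relSource_comb_half`, `Pi`-difference spelling — IFF `zmodeSym_Lc (T̃′♮_{l+1}) = zmodeSym_Lc (T̃′♮_l)` there (§1 at `N := Lc`, charge factor `1` by
`T2RecChargeLedger.charge_factor_eq_one_of_pinEq`). -/
theorem zsymMember_comb_succ_eq_iff_rowC (tabs : SymTables d Lc) (cE cVH cΛ cE₂ cB : ℝ) (Tc : Fin 4 → Fin 4 → Fin 4 → Fin 4 → ℝ)
    (hpinEq : cE₂ = (Lc : ℝ) ^ (d + 5)) (l : ℕ) (κ κ' κ₁ κ₂ : Fin (d + 1)) :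
    (zmode Lc ((unitS₂ (sfStep Lc (l + 1)) (smStep d Lc (l + 1)) (T2RecOf d Lc (GcombSh Lc) (SpureCombOf tabs cE cVH cΛ) tabs.M cE₂ cB Tc tabs.vh₂S tabs.mixFF (l + 1)))
            - lin4 (cE₂ * (Lc : ℝ) ^ (2 * (d + 1))) (unitK (sfStep Lc l) (smStep d Lc l) (KInvStep (d := d) Lc l)) Lc
              (unitS₂ (sfStep Lc l) (smStep d Lc l) (T2RecOf d Lc (GcombSh Lc) (SpureCombOf tabs cE cVH cΛ) tabs.M cE₂ cB Tc tabs.vh₂S tabs.mixFF l))) κ κ' (Sum.inl κ₁) (Sum.inl κ₂)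
        + zmode Lc ((unitS₂ (sfStep Lc (l + 1)) (smStep d Lc (l + 1)) (T2RecOf d Lc (GcombSh Lc) (SpureCombOf tabs cE cVH cΛ) tabs.M cE₂ cB Tc tabs.vh₂S tabs.mixFF (l + 1)))
            - lin4 (cE₂ * (Lc : ℝ) ^ (2 * (d + 1))) (unitK (sfStep Lc l) (smStep d Lc l) (KInvStep (d := d) Lc l)) Lc
              (unitS₂ (sfStep Lc l) (smStep d Lc l) (T2RecOf d Lc (GcombSh Lc) (SpureCombOf tabs cE cVH cΛ) tabs.M cE₂ cB Tc tabs.vh₂S tabs.mixFF l))) κ' κ (Sum.inl κ₁) (Sum.inl κ₂) = 0)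
      ↔ zmode Lc (unitS₂ (sfStep Lc (l + 1)) (smStep d Lc (l + 1)) (T2RecOf d Lc (GcombSh Lc) (SpureCombOf tabs cE cVH cΛ) tabs.M cE₂ cB Tc tabs.vh₂S tabs.mixFF (l + 1))) κ κ' (Sum.inl κ₁) (Sum.inl κ₂)
        + zmode Lc (unitS₂ (sfStep Lc (l + 1)) (smStep d Lc (l + 1)) (T2RecOf d Lc (GcombSh Lc) (SpureCombOf tabs cE cVH cΛ) tabs.M cE₂ cB Tc tabs.vh₂S tabs.mixFF (l + 1))) κ' κ (Sum.inl κ₁) (Sum.inl κ₂)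
          = zmode Lc (unitS₂ (sfStep Lc l) (smStep d Lc l) (T2RecOf d Lc (GcombSh Lc) (SpureCombOf tabs cE cVH cΛ) tabs.M cE₂ cB Tc tabs.vh₂S tabs.mixFF l)) κ κ' (Sum.inl κ₁) (Sum.inl κ₂)
        + zmode Lc (unitS₂ (sfStep Lc l) (smStep d Lc l) (T2RecOf d Lc (GcombSh Lc) (SpureCombOf tabs cE cVH cΛ) tabs.M cE₂ cB Tc tabs.vh₂S tabs.mixFF l)) κ' κ (Sum.inl κ₁) (Sum.inl κ₂) := by
  have h := zfreeSym_sourceB_comb_iff tabs cE cVH cΛ cE₂ cB Tc Lc l κ κ' κ₁ κ₂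
  rw [charge_factor_eq_one_of_pinEq (d := d) (Lc := Lc) hpinEq, one_mul] at h
  -- the `Pi`-difference spelling of the source is the pointwise one by `rfl` (leaf-01 g73's `RowCChargeForms.zmode_pi_sub`)
  exact h

/-- NOT IN PRINT; OUR BOOKKEEPING.  **ROW (C) AT EVERY LEVEL ⟹ THE COMB-CHART TOWER's SYMMETRISED ff CHARGE IS ITS LEVEL-`0` VALUE AT EVERY LEVEL** (induction on the level with
the one-step form; twin of `RowCChargeForms.zsymMember_eq_zero_level_of_rowC`). -/
theorem zsymMember_comb_eq_zero_level_of_rowC (tabs : SymTables d Lc) (cE cVH cΛ cE₂ cB : ℝ) (Tc : Fin 4 → Fin 4 → Fin 4 → Fin 4 → ℝ)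
    (hpinEq : cE₂ = (Lc : ℝ) ^ (d + 5))
    (hC : ∀ (l : ℕ) (κ κ' κ₁ κ₂ : Fin (d + 1)),
      zmode Lc ((unitS₂ (sfStep Lc (l + 1)) (smStep d Lc (l + 1)) (T2RecOf d Lc (GcombSh Lc) (SpureCombOf tabs cE cVH cΛ) tabs.M cE₂ cB Tc tabs.vh₂S tabs.mixFF (l + 1)))
            - lin4 (cE₂ * (Lc : ℝ) ^ (2 * (d + 1))) (unitK (sfStep Lc l) (smStep d Lc l) (KInvStep (d := d) Lc l)) Lc
              (unitS₂ (sfStep Lc l) (smStep d Lc l) (T2RecOf d Lc (GcombSh Lc) (SpureCombOf tabs cE cVH cΛ) tabs.M cE₂ cB Tc tabs.vh₂S tabs.mixFF l))) κ κ' (Sum.inl κ₁) (Sum.inl κ₂)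
        + zmode Lc ((unitS₂ (sfStep Lc (l + 1)) (smStep d Lc (l + 1)) (T2RecOf d Lc (GcombSh Lc) (SpureCombOf tabs cE cVH cΛ) tabs.M cE₂ cB Tc tabs.vh₂S tabs.mixFF (l + 1)))
            - lin4 (cE₂ * (Lc : ℝ) ^ (2 * (d + 1))) (unitK (sfStep Lc l) (smStep d Lc l) (KInvStep (d := d) Lc l)) Lc
              (unitS₂ (sfStep Lc l) (smStep d Lc l) (T2RecOf d Lc (GcombSh Lc) (SpureCombOf tabs cE cVH cΛ) tabs.M cE₂ cB Tc tabs.vh₂S tabs.mixFF l))) κ' κ (Sum.inl κ₁) (Sum.inl κ₂) = 0)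
    (n : ℕ) (κ κ' κ₁ κ₂ : Fin (d + 1)) :
    zmode Lc (unitS₂ (sfStep Lc n) (smStep d Lc n) (T2RecOf d Lc (GcombSh Lc) (SpureCombOf tabs cE cVH cΛ) tabs.M cE₂ cB Tc tabs.vh₂S tabs.mixFF n)) κ κ' (Sum.inl κ₁) (Sum.inl κ₂)
        + zmode Lc (unitS₂ (sfStep Lc n) (smStep d Lc n) (T2RecOf d Lc (GcombSh Lc) (SpureCombOf tabs cE cVH cΛ) tabs.M cE₂ cB Tc tabs.vh₂S tabs.mixFF n)) κ' κ (Sum.inl κ₁) (Sum.inl κ₂)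
      = zmode Lc (unitS₂ (sfStep Lc 0) (smStep d Lc 0) (T2RecOf d Lc (GcombSh Lc) (SpureCombOf tabs cE cVH cΛ) tabs.M cE₂ cB Tc tabs.vh₂S tabs.mixFF 0)) κ κ' (Sum.inl κ₁) (Sum.inl κ₂)
        + zmode Lc (unitS₂ (sfStep Lc 0) (smStep d Lc 0) (T2RecOf d Lc (GcombSh Lc) (SpureCombOf tabs cE cVH cΛ) tabs.M cE₂ cB Tc tabs.vh₂S tabs.mixFF 0)) κ' κ (Sum.inl κ₁) (Sum.inl κ₂) := by
  induction n with
  | zero => rfl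
  | succ n ih =>
    rw [← ih]
    exact (zsymMember_comb_succ_eq_iff_rowC tabs cE cVH cΛ cE₂ cB Tc hpinEq n κ κ' κ₁ κ₂).1 (hC n κ κ' κ₁ κ₂)

/-- NOT IN PRINT; OUR BOOKKEEPING.  **THE CONVERSE** (twin of `RowCChargeForms.rowC_of_zsymMember_eq_zero_level`): if the comb-chart tower's symmetrised ff charge is its
level-`0` value at every level, row (C) holds at the comb data at every level. -/
theorem rowC_comb_of_zsymMember_eq_zero_level (tabs : SymTables d Lc) (cE cVH cΛ cE₂ cB : ℝ) (Tc : Fin 4 → Fin 4 → Fin 4 → Fin 4 → ℝ)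
    (hpinEq : cE₂ = (Lc : ℝ) ^ (d + 5))
    (hZ : ∀ (n : ℕ) (κ κ' κ₁ κ₂ : Fin (d + 1)),
      zmode Lc (unitS₂ (sfStep Lc n) (smStep d Lc n) (T2RecOf d Lc (GcombSh Lc) (SpureCombOf tabs cE cVH cΛ) tabs.M cE₂ cB Tc tabs.vh₂S tabs.mixFF n)) κ κ' (Sum.inl κ₁) (Sum.inl κ₂)
        + zmode Lc (unitS₂ (sfStep Lc n) (smStep d Lc n) (T2RecOf d Lc (GcombSh Lc) (SpureCombOf tabs cE cVH cΛ) tabs.M cE₂ cB Tc tabs.vh₂S tabs.mixFF n)) κ' κ (Sum.inl κ₁) (Sum.inl κ₂)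
        = zmode Lc (unitS₂ (sfStep Lc 0) (smStep d Lc 0) (T2RecOf d Lc (GcombSh Lc) (SpureCombOf tabs cE cVH cΛ) tabs.M cE₂ cB Tc tabs.vh₂S tabs.mixFF 0)) κ κ' (Sum.inl κ₁) (Sum.inl κ₂)
        + zmode Lc (unitS₂ (sfStep Lc 0) (smStep d Lc 0) (T2RecOf d Lc (GcombSh Lc) (SpureCombOf tabs cE cVH cΛ) tabs.M cE₂ cB Tc tabs.vh₂S tabs.mixFF 0)) κ' κ (Sum.inl κ₁) (Sum.inl κ₂))
    (l : ℕ) (κ κ' κ₁ κ₂ : Fin (d + 1)) :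
    zmode Lc ((unitS₂ (sfStep Lc (l + 1)) (smStep d Lc (l + 1)) (T2RecOf d Lc (GcombSh Lc) (SpureCombOf tabs cE cVH cΛ) tabs.M cE₂ cB Tc tabs.vh₂S tabs.mixFF (l + 1)))
            - lin4 (cE₂ * (Lc : ℝ) ^ (2 * (d + 1))) (unitK (sfStep Lc l) (smStep d Lc l) (KInvStep (d := d) Lc l)) Lc
              (unitS₂ (sfStep Lc l) (smStep d Lc l) (T2RecOf d Lc (GcombSh Lc) (SpureCombOf tabs cE cVH cΛ) tabs.M cE₂ cB Tc tabs.vh₂S tabs.mixFF l))) κ κ' (Sum.inl κ₁) (Sum.inl κ₂)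
        + zmode Lc ((unitS₂ (sfStep Lc (l + 1)) (smStep d Lc (l + 1)) (T2RecOf d Lc (GcombSh Lc) (SpureCombOf tabs cE cVH cΛ) tabs.M cE₂ cB Tc tabs.vh₂S tabs.mixFF (l + 1)))
            - lin4 (cE₂ * (Lc : ℝ) ^ (2 * (d + 1))) (unitK (sfStep Lc l) (smStep d Lc l) (KInvStep (d := d) Lc l)) Lc
              (unitS₂ (sfStep Lc l) (smStep d Lc l) (T2RecOf d Lc (GcombSh Lc) (SpureCombOf tabs cE cVH cΛ) tabs.M cE₂ cB Tc tabs.vh₂S tabs.mixFF l))) κ' κ (Sum.inl κ₁) (Sum.inl κ₂) = 0 := by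
  refine (zsymMember_comb_succ_eq_iff_rowC tabs cE cVH cΛ cE₂ cB Tc hpinEq l κ κ' κ₁ κ₂).2 ?_
  rw [hZ (l + 1) κ κ' κ₁ κ₂, hZ l κ κ' κ₁ κ₂]

/-- NOT IN PRINT; OUR BOOKKEEPING.  **ROW (C) AT THE COMB DATA ⟺ CONSERVATION OF THE SYMMETRISED ff CHARGE ALONG THE COMB-CHART TOWER** (the two theorems above packaged;
twin of `RowCChargeForms.rowC_iff_zsymMember_conserved`). -/
theorem rowC_comb_iff_zsymMember_conserved (tabs : SymTables d Lc) (cE cVH cΛ cE₂ cB : ℝ) (Tc : Fin 4 → Fin 4 → Fin 4 → Fin 4 → ℝ)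
    (hpinEq : cE₂ = (Lc : ℝ) ^ (d + 5)) :
    (∀ (l : ℕ) (κ κ' κ₁ κ₂ : Fin (d + 1)),
      zmode Lc ((unitS₂ (sfStep Lc (l + 1)) (smStep d Lc (l + 1)) (T2RecOf d Lc (GcombSh Lc) (SpureCombOf tabs cE cVH cΛ) tabs.M cE₂ cB Tc tabs.vh₂S tabs.mixFF (l + 1)))
            - lin4 (cE₂ * (Lc : ℝ) ^ (2 * (d + 1))) (unitK (sfStep Lc l) (smStep d Lc l) (KInvStep (d := d) Lc l)) Lc
              (unitS₂ (sfStep Lc l) (smStep d Lc l) (T2RecOf d Lc (GcombSh Lc) (SpureCombOf tabs cE cVH cΛ) tabs.M cE₂ cB Tc tabs.vh₂S tabs.mixFF l))) κ κ' (Sum.inl κ₁) (Sum.inl κ₂)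
        + zmode Lc ((unitS₂ (sfStep Lc (l + 1)) (smStep d Lc (l + 1)) (T2RecOf d Lc (GcombSh Lc) (SpureCombOf tabs cE cVH cΛ) tabs.M cE₂ cB Tc tabs.vh₂S tabs.mixFF (l + 1)))
            - lin4 (cE₂ * (Lc : ℝ) ^ (2 * (d + 1))) (unitK (sfStep Lc l) (smStep d Lc l) (KInvStep (d := d) Lc l)) Lc
              (unitS₂ (sfStep Lc l) (smStep d Lc l) (T2RecOf d Lc (GcombSh Lc) (SpureCombOf tabs cE cVH cΛ) tabs.M cE₂ cB Tc tabs.vh₂S tabs.mixFF l))) κ' κ (Sum.inl κ₁) (Sum.inl κ₂) = 0)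
      ↔ ∀ (n : ℕ) (κ κ' κ₁ κ₂ : Fin (d + 1)),
        zmode Lc (unitS₂ (sfStep Lc n) (smStep d Lc n) (T2RecOf d Lc (GcombSh Lc) (SpureCombOf tabs cE cVH cΛ) tabs.M cE₂ cB Tc tabs.vh₂S tabs.mixFF n)) κ κ' (Sum.inl κ₁) (Sum.inl κ₂)
        + zmode Lc (unitS₂ (sfStep Lc n) (smStep d Lc n) (T2RecOf d Lc (GcombSh Lc) (SpureCombOf tabs cE cVH cΛ) tabs.M cE₂ cB Tc tabs.vh₂S tabs.mixFF n)) κ' κ (Sum.inl κ₁) (Sum.inl κ₂)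
          = zmode Lc (unitS₂ (sfStep Lc 0) (smStep d Lc 0) (T2RecOf d Lc (GcombSh Lc) (SpureCombOf tabs cE cVH cΛ) tabs.M cE₂ cB Tc tabs.vh₂S tabs.mixFF 0)) κ κ' (Sum.inl κ₁) (Sum.inl κ₂)
        + zmode Lc (unitS₂ (sfStep Lc 0) (smStep d Lc 0) (T2RecOf d Lc (GcombSh Lc) (SpureCombOf tabs cE cVH cΛ) tabs.M cE₂ cB Tc tabs.vh₂S tabs.mixFF 0)) κ' κ (Sum.inl κ₁) (Sum.inl κ₂) :=
  ⟨fun hC => zsymMember_comb_eq_zero_level_of_rowC tabs cE cVH cΛ cE₂ cB Tc hpinEq hC,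
    fun hZ => rowC_comb_of_zsymMember_eq_zero_level tabs cE cVH cΛ cE₂ cB Tc hpinEq hZ⟩

/-! ## §2b The conserved value: member `0` of the comb-chart tower carries the Wilson charge (generic `d`, any period `N`) -/

/-- NOT IN PRINT; OUR BOOKKEEPING.  **THE FIELD–FIELD CHARGE OF MEMBER `0` OF THE COMB-CHART TOWER** at any period `N`, for ANY sym record whose second-order border has no
field–field block (`hBff`, displayed; `rfl` at an1's record): `zmode N T̃′♮_0 (μ,ν;α,β) = cE₂ · N^{d+1} · Z₄(Tc)(μ,ν;α,β)` — gan24-p2 g36's `T2RecChargeStep.zmode_member_zero` BY NAME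
(member `0` of `T2RecOf` at the comb slots and member `0` of `T2RecAt` are the SAME table `cE₂ • wilsonW₂ d Tc + cB • vh₂S`, `T2RecOf_zero_level ∕ T2RecAt_zero_level`, both `rfl`).
With §2 this is the VALUE the conservation row (d′) propagates: `zmodeSym_Lc (T̃′♮_l) = cE₂·Lc^{d+1}·(Z₄(Tc)(κκ′) + Z₄(Tc)(κ′κ))` at every level. -/
theorem zmode_member_zero_comb (tabs : SymTables d Lc) (N : ℕ) (cE cVH cΛ cE₂ cB : ℝ) (Tc : Fin 4 → Fin 4 → Fin 4 → Fin 4 → ℝ)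
    (hBff : ∀ κ u κ' u' x z (α β : Fin (d + 1)), tabs.vh₂S κ u κ' u' x z (Sum.inl α) (Sum.inl β) = 0) (μ ν α β : Fin (d + 1)) :
    zmode N (unitS₂ (sfStep Lc 0) (smStep d Lc 0)
        (T2RecOf d Lc (GcombSh Lc) (SpureCombOf tabs cE cVH cΛ) tabs.M cE₂ cB Tc tabs.vh₂S tabs.mixFF 0)) μ ν (Sum.inl α) (Sum.inl β)
      = cE₂ * (((N : ℝ) ^ (d + 1)) *
          ∑' u' : Fin (d + 1) → ℤ, ∑' x : Fin (d + 1) → ℤ, ∑' z : Fin (d + 1) → ℤ,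
            wilsonW₂ d Tc μ 0 ν u' x z (Sum.inl α) (Sum.inl β)) := by
  have h := zmode_member_zero (Lc := Lc) N cE cVH cΛ cE₂ cB Tc (0 : Fin (d + 1) → ℤ) (vh₂S := tabs.vh₂S) (mixFF := tabs.mixFF) hBff μ ν α β
  rw [T2RecAt_zero_level] at h
  rw [T2RecOf_zero_level]
  exact h

/-! ## §3 `d = 3`, an1's record: the (III′) END with the (C)^{ev} row in conservation currency -/

/-- NOT IN PRINT; OUR BOOKKEEPING.  **THE G-an2-4 END AT ROW D1's LITERAL OF RECORD (III′) FROM (b) THE S-SLOT ROWS OF `ScombOf` AND (d′) ONE-STEP CONSERVATION OF THE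
COMB-CHART TOWER's BOND-SYMMETRISED ff ZERO-MODE CHARGE — NOTHING ELSE** (`Lc` odd, `2 ≤ Lc`, `2 ≤ N`, an1's record `symTablesAn1S2 3 Lc cΛ`, locks `cΛ·Lc⁴ = 2`,
`cB = −Lc¹²∕4`, the END's pins written in): leaf-01 g83's `CombTowerEndAtPin.exists_allScalesSeq_JsB12CombShSym_an1_of_sRows_at_pin` with its row `hC` SUPPLIED from (d′) by
§2's one-step form (pin `Lc⁸ = Lc^{3+5}` by `norm_num`) ⨾ leaf-01 g80's `CombRelSourceHalfCharge.zsym_relSource_comb_half` at `ε = 1` (the record's border has no ff ∕ mm block: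
`rfl`) ⨾ `one_smul` (junction spelling).  (d′) is DISPLAYED, NOT proved — its truth at the comb data is the engine question. -/
theorem exists_allScalesSeq_JsB12CombShSym_an1_of_sRows_chargeConserved (hLc : Odd Lc) (hLc2 : 2 ≤ Lc) {N : ℕ} (hN : 2 ≤ N) {cΛ cB : ℝ} (hΛ : cΛ * (Lc : ℝ) ^ 4 = 2) (hcB : cB = -((Lc : ℝ) ^ 12 / 4))
    {Cs cS θS δS : ℝ}
    (hS : ∀ j, LocStencil (unitS (sfStep Lc j) (smStep 3 Lc j) (ScombOf (symTablesAn1S2 3 Lc cΛ) ((Lc : ℝ) ^ 4) (-((Lc : ℝ) ^ 8 / 2)) cΛ j)) Cs δS)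
    (hSall : ∀ k j, LocStencil (unitS (sfStep Lc (k + j)) (smStep 3 Lc (k + j)) (ScombOf (symTablesAn1S2 3 Lc cΛ) ((Lc : ℝ) ^ 4) (-((Lc : ℝ) ^ 8 / 2)) cΛ (k + j)) -
      unitS (sfStep Lc k) (smStep 3 Lc k) (ScombOf (symTablesAn1S2 3 Lc cΛ) ((Lc : ℝ) ^ 4) (-((Lc : ℝ) ^ 8 / 2)) cΛ k)) (cS * θS ^ k) δS)
    (hδS : 0 < δS) (hθS0 : 0 ≤ θS) (hθS1 : θS < 1)
    -- (d′) THE COMB-CHART `T₂` TOWER CONSERVES ITS BOND-SYMMETRISED ff ZERO-MODE CHARGE, level by level (in place of the (C)^{ev} row `hC`)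
    (hcons : ∀ (l : ℕ) (κ κ' κ₁ κ₂ : Fin (3 + 1)),
      zmode Lc (unitS₂ (sfStep Lc (l + 1)) (smStep 3 Lc (l + 1)) (T2RecOf 3 Lc (GcombSh Lc) (SpureCombOf (symTablesAn1S2 3 Lc cΛ) ((Lc : ℝ) ^ 4) (-((Lc : ℝ) ^ 8 / 2)) cΛ) (symTablesAn1S2 3 Lc cΛ).M ((Lc : ℝ) ^ 8) cB ((8 * (N : ℝ) ^ 2)⁻¹ • wsym22 N) (symTablesAn1S2 3 Lc cΛ).vh₂S (symTablesAn1S2 3 Lc cΛ).mixFF (l + 1))) κ κ' (Sum.inl κ₁) (Sum.inl κ₂)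
        + zmode Lc (unitS₂ (sfStep Lc (l + 1)) (smStep 3 Lc (l + 1)) (T2RecOf 3 Lc (GcombSh Lc) (SpureCombOf (symTablesAn1S2 3 Lc cΛ) ((Lc : ℝ) ^ 4) (-((Lc : ℝ) ^ 8 / 2)) cΛ) (symTablesAn1S2 3 Lc cΛ).M ((Lc : ℝ) ^ 8) cB ((8 * (N : ℝ) ^ 2)⁻¹ • wsym22 N) (symTablesAn1S2 3 Lc cΛ).vh₂S (symTablesAn1S2 3 Lc cΛ).mixFF (l + 1))) κ' κ (Sum.inl κ₁) (Sum.inl κ₂)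
      = zmode Lc (unitS₂ (sfStep Lc l) (smStep 3 Lc l) (T2RecOf 3 Lc (GcombSh Lc) (SpureCombOf (symTablesAn1S2 3 Lc cΛ) ((Lc : ℝ) ^ 4) (-((Lc : ℝ) ^ 8 / 2)) cΛ) (symTablesAn1S2 3 Lc cΛ).M ((Lc : ℝ) ^ 8) cB ((8 * (N : ℝ) ^ 2)⁻¹ • wsym22 N) (symTablesAn1S2 3 Lc cΛ).vh₂S (symTablesAn1S2 3 Lc cΛ).mixFF l)) κ κ' (Sum.inl κ₁) (Sum.inl κ₂)
        + zmode Lc (unitS₂ (sfStep Lc l) (smStep 3 Lc l) (T2RecOf 3 Lc (GcombSh Lc) (SpureCombOf (symTablesAn1S2 3 Lc cΛ) ((Lc : ℝ) ^ 4) (-((Lc : ℝ) ^ 8 / 2)) cΛ) (symTablesAn1S2 3 Lc cΛ).M ((Lc : ℝ) ^ 8) cB ((8 * (N : ℝ) ^ 2)⁻¹ • wsym22 N) (symTablesAn1S2 3 Lc cΛ).vh₂S (symTablesAn1S2 3 Lc cΛ).mixFF l)) κ' κ (Sum.inl κ₁) (Sum.inl κ₂))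
    (μ ν : Fin 4) :
    ∃ κ θ : ℝ, 0 ≤ θ ∧ θ < 1 ∧ AllScalesSeq (fun j => B12Beta.secondMoment (TbalOf Lc (JsB12CombShSym hLc N (symTablesAn1S2 3 Lc cΛ) cΛ cB) j) μ ν) κ θ := by
  refine exists_allScalesSeq_JsB12CombShSym_an1_of_sRows_at_pin hLc hLc2 hN hΛ hcB hS hSall hδS hθS0 hθS1 ?_ μ ν
  have hpin : ((Lc : ℝ) ^ 8) = (Lc : ℝ) ^ (3 + 5) := by norm_num
  have hrow := fun (l : ℕ) (κ κ' κ₁ κ₂ : Fin (3 + 1)) =>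
    (zsymMember_comb_succ_eq_iff_rowC (d := 3) (symTablesAn1S2 3 Lc cΛ) ((Lc : ℝ) ^ 4) (-((Lc : ℝ) ^ 8 / 2)) cΛ ((Lc : ℝ) ^ 8) cB
      ((8 * (N : ℝ) ^ 2)⁻¹ • wsym22 N) hpin l κ κ' κ₁ κ₂).2 (hcons l κ κ' κ₁ κ₂)
  intro l κ κ' κ₁ κ₂
  simpa only [one_smul] using
    zsym_relSource_comb_half (d := 3) (symTablesAn1S2 3 Lc cΛ) ((Lc : ℝ) ^ 4) (-((Lc : ℝ) ^ 8 / 2)) cΛ ((Lc : ℝ) ^ 8) cB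
      ((8 * (N : ℝ) ^ 2)⁻¹ • wsym22 N) (fun _ _ _ _ _ _ _ _ => rfl) (fun _ _ _ _ _ _ _ _ => rfl) 1 hrow l κ κ' κ₁ κ₂

/-- NOT IN PRINT; OUR BOOKKEEPING.  **ROW D1's READING `↔ lim β = stepBal` AT THE LITERAL OF RECORD FROM (b) THE S-SLOT ROWS AND (d′) THE CONSERVATION ROW** (leaf-01 g83's
`CombTowerEndAtPin.d1Drift_JsB12CombShSym_an1_iff_lim_eq_of_sRows_at_pin` with `hC` supplied as in the previous theorem; the VALUE `lim β = stepBal Nc Lc` is row D1's and is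
NOT proved). -/
theorem d1Drift_JsB12CombShSym_an1_iff_lim_eq_of_sRows_chargeConserved (hLc : Odd Lc) (hLc2 : 2 ≤ Lc) {N : ℕ} (hN : 2 ≤ N) {cΛ cB : ℝ} (hΛ : cΛ * (Lc : ℝ) ^ 4 = 2) (hcB : cB = -((Lc : ℝ) ^ 12 / 4))
    {Cs cS θS δS : ℝ}
    (hS : ∀ j, LocStencil (unitS (sfStep Lc j) (smStep 3 Lc j) (ScombOf (symTablesAn1S2 3 Lc cΛ) ((Lc : ℝ) ^ 4) (-((Lc : ℝ) ^ 8 / 2)) cΛ j)) Cs δS)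
    (hSall : ∀ k j, LocStencil (unitS (sfStep Lc (k + j)) (smStep 3 Lc (k + j)) (ScombOf (symTablesAn1S2 3 Lc cΛ) ((Lc : ℝ) ^ 4) (-((Lc : ℝ) ^ 8 / 2)) cΛ (k + j)) -
      unitS (sfStep Lc k) (smStep 3 Lc k) (ScombOf (symTablesAn1S2 3 Lc cΛ) ((Lc : ℝ) ^ 4) (-((Lc : ℝ) ^ 8 / 2)) cΛ k)) (cS * θS ^ k) δS)
    (hδS : 0 < δS) (hθS0 : 0 ≤ θS) (hθS1 : θS < 1)
    -- (d′) THE COMB-CHART `T₂` TOWER CONSERVES ITS BOND-SYMMETRISED ff ZERO-MODE CHARGE, level by level (in place of the (C)^{ev} row `hC`)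
    (hcons : ∀ (l : ℕ) (κ κ' κ₁ κ₂ : Fin (3 + 1)),
      zmode Lc (unitS₂ (sfStep Lc (l + 1)) (smStep 3 Lc (l + 1)) (T2RecOf 3 Lc (GcombSh Lc) (SpureCombOf (symTablesAn1S2 3 Lc cΛ) ((Lc : ℝ) ^ 4) (-((Lc : ℝ) ^ 8 / 2)) cΛ) (symTablesAn1S2 3 Lc cΛ).M ((Lc : ℝ) ^ 8) cB ((8 * (N : ℝ) ^ 2)⁻¹ • wsym22 N) (symTablesAn1S2 3 Lc cΛ).vh₂S (symTablesAn1S2 3 Lc cΛ).mixFF (l + 1))) κ κ' (Sum.inl κ₁) (Sum.inl κ₂)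
        + zmode Lc (unitS₂ (sfStep Lc (l + 1)) (smStep 3 Lc (l + 1)) (T2RecOf 3 Lc (GcombSh Lc) (SpureCombOf (symTablesAn1S2 3 Lc cΛ) ((Lc : ℝ) ^ 4) (-((Lc : ℝ) ^ 8 / 2)) cΛ) (symTablesAn1S2 3 Lc cΛ).M ((Lc : ℝ) ^ 8) cB ((8 * (N : ℝ) ^ 2)⁻¹ • wsym22 N) (symTablesAn1S2 3 Lc cΛ).vh₂S (symTablesAn1S2 3 Lc cΛ).mixFF (l + 1))) κ' κ (Sum.inl κ₁) (Sum.inl κ₂)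
      = zmode Lc (unitS₂ (sfStep Lc l) (smStep 3 Lc l) (T2RecOf 3 Lc (GcombSh Lc) (SpureCombOf (symTablesAn1S2 3 Lc cΛ) ((Lc : ℝ) ^ 4) (-((Lc : ℝ) ^ 8 / 2)) cΛ) (symTablesAn1S2 3 Lc cΛ).M ((Lc : ℝ) ^ 8) cB ((8 * (N : ℝ) ^ 2)⁻¹ • wsym22 N) (symTablesAn1S2 3 Lc cΛ).vh₂S (symTablesAn1S2 3 Lc cΛ).mixFF l)) κ κ' (Sum.inl κ₁) (Sum.inl κ₂)
        + zmode Lc (unitS₂ (sfStep Lc l) (smStep 3 Lc l) (T2RecOf 3 Lc (GcombSh Lc) (SpureCombOf (symTablesAn1S2 3 Lc cΛ) ((Lc : ℝ) ^ 4) (-((Lc : ℝ) ^ 8 / 2)) cΛ) (symTablesAn1S2 3 Lc cΛ).M ((Lc : ℝ) ^ 8) cB ((8 * (N : ℝ) ^ 2)⁻¹ • wsym22 N) (symTablesAn1S2 3 Lc cΛ).vh₂S (symTablesAn1S2 3 Lc cΛ).mixFF l)) κ' κ (Sum.inl κ₁) (Sum.inl κ₂))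
    (μ ν : Fin 4) (Nc : ℝ) :
    D1Drift Lc (JsB12CombShSym hLc N (symTablesAn1S2 3 Lc cΛ) cΛ cB) Nc μ ν ↔
      RateCertificate.CauchyRate.lim (fun j => B12Beta.secondMoment (TbalOf Lc (JsB12CombShSym hLc N (symTablesAn1S2 3 Lc cΛ) cΛ cB) j) μ ν) =
        B12Normalization.stepBal Nc Lc := by
  refine d1Drift_JsB12CombShSym_an1_iff_lim_eq_of_sRows_at_pin hLc hLc2 hN hΛ hcB hS hSall hδS hθS0 hθS1 ?_ μ ν Nc
  have hpin : ((Lc : ℝ) ^ 8) = (Lc : ℝ) ^ (3 + 5) := by norm_num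
  have hrow := fun (l : ℕ) (κ κ' κ₁ κ₂ : Fin (3 + 1)) =>
    (zsymMember_comb_succ_eq_iff_rowC (d := 3) (symTablesAn1S2 3 Lc cΛ) ((Lc : ℝ) ^ 4) (-((Lc : ℝ) ^ 8 / 2)) cΛ ((Lc : ℝ) ^ 8) cB
      ((8 * (N : ℝ) ^ 2)⁻¹ • wsym22 N) hpin l κ κ' κ₁ κ₂).2 (hcons l κ κ' κ₁ κ₂)
  intro l κ κ' κ₁ κ₂
  simpa only [one_smul] using
    zsym_relSource_comb_half (d := 3) (symTablesAn1S2 3 Lc cΛ) ((Lc : ℝ) ^ 4) (-((Lc : ℝ) ^ 8 / 2)) cΛ ((Lc : ℝ) ^ 8) cB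
      ((8 * (N : ℝ) ^ 2)⁻¹ • wsym22 N) (fun _ _ _ _ _ _ _ _ => rfl) (fun _ _ _ _ _ _ _ _ => rfl) 1 hrow l κ κ' κ₁ κ₂

end Summit.QuantumFields.BalabanUV.Beta.GAN24.CombChargeConservationRow

end
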